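import Summits.QuantumAdvantage.QuantumAdvantage.Theorems.MobiusLadderLiouvilleOrthogonalTC0StubAutomaticFamily
import Summits.QuantumAdvantage.QuantumAdvantage.Theorems.MobiusLadderLiouvilleOrthogonalTC0StubScanRung
import Literature.Computability.Complexity.Circuit
import HarnessLib

/-!
# Crux `MobiusLadder.LiouvilleOrthogonalTC0` (stmt-QuantumAdvantage-1393), line `Sketch`, skeleton v9:
# the FINITE-STATE-SCAN RUNG, packaged (modulo Müllner's theorem)

Assuming the printed theorem of C. Müllner, *Automatic sequences fulfill the Sarnak conjecture*,
Duke Math. J. 166 (2017), Thm. 1.2 — the tree's named fact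
`Literature.NumberTheory.LFunctions.mullner_moebius_automatic`, never asserted, taken as the
hypothesis `hM` — the Liouville function is asymptotically orthogonal, for every fixed number of
states `S` and UNIFORMLY in the automaton, to every Boolean function computed by an `S`-state
automaton scanning the `n` input bits `x₀, …, x_{n-1}` (least significant bit first, the high zero
bits included) or `x_{n-1}, …, x₀` (most significant first): parity, `s₂(N) mod m`, `N mod q`, the
Rudin–Shapiro sign, every digit-pattern detector — the regular languages sliced at length `n`, i.e.
width-`S` read-once oblivious branching programs in digit order. Assembled from the landed v9 stubs
`stub_automaticFamily` (p138883: Müllner for `λ` uniformly over the finite family of `S`-state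
automata on the canonical binary digits, both reading directions; the `λ`-form of Müllner's theorem
is the tree's `MobiusLadder.liouville_automatic_of_mullner`, `λ = 𝟙_□ ⋆ μ` plus Cobham's closure,
so NO unprinted `λ`-hypothesis enters) and `stub_scanRung` (p139014: padded scans of length `n` split
along the binary length of `N`):

* `liouville_orthogonal_scan_of_mullner` — the rung for the raw scans (both directions);
* `liouville_orthogonal_circuit_scan_of_mullner` — circuit language: every circuit (any basis, depth,
  size) that computes, on `{0,1}ⁿ`, the output of some `S`-state automaton scanning `x₀ … x_{n-1}`;
* `liouville_orthogonal_circuit_scanMSB_of_mullner` — the same for scans of `x_{n-1} … x₀`.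
-/

set_option linter.dupNamespace false -- D-0017: single-problem summit ⇒ `QuantumAdvantage.QuantumAdvantage` by design

noncomputable section

namespace Summit.QuantumAdvantage.QuantumAdvantage.Theorems.LiouvilleOrthogonalTC0

open Filter Finset
open Literature.Computability.Complexity
open Literature.Probability.RandomGraphs.LowDegree (sgn)

/-- **The finite-state-scan rung (modulo Müllner's theorem).** Assuming
`mullner_moebius_automatic`: for every `S` and `ε > 0`, eventually in `n`, for ALL `S`-state
automata `(δ, q₀, τ)` over the alphabet `Bool`, both the scan of `x₀, …, x_{n-1}` and the scan of
`x_{n-1}, …, x₀` are `ε 2ⁿ`-orthogonal to `λ` on `N < 2ⁿ` (`x_i = N.testBit i`). -/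
theorem liouville_orthogonal_scan_of_mullner
    (hM : Literature.NumberTheory.LFunctions.mullner_moebius_automatic) (S : ℕ) :
    ∀ ε : ℝ, 0 < ε → ∀ᶠ n : ℕ in atTop,
      ∀ (δ : Fin S → Bool → Fin S) (q₀ : Fin S) (τ : Fin S → Bool),
        |∑ N ∈ Finset.range (2 ^ n), ((ArithmeticFunction.liouville N : ℤ) : ℝ) *
            sgn (τ (List.foldl δ q₀ (List.ofFn fun i : Fin n => Nat.testBit N i)))| ≤ ε * (2 : ℝ) ^ n ∧
        |∑ N ∈ Finset.range (2 ^ n), ((ArithmeticFunction.liouville N : ℤ) : ℝ) *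
            sgn (τ (List.foldl δ q₀ (List.ofFn fun i : Fin n => Nat.testBit N i).reverse))| ≤ ε * (2 : ℝ) ^ n :=
  stub_scanRung (fun S' ε' hε' => stub_automaticFamily hM S' ε' hε') S

/-- **The finite-state-scan rung in circuit language, LSB-first scans (modulo Müllner's theorem).**
Assuming `mullner_moebius_automatic`: for every `S` and `ε > 0`, eventually in `n`, every circuit
`C` on the `n` binary digits — over ANY gate basis, of any depth and size — which computes on
`{0,1}ⁿ` the output of some `S`-state automaton scanning `x₀, x₁, …, x_{n-1}` satisfies
`|Σ_{N<2ⁿ} λ(N) sgn C(bits N)| ≤ ε 2ⁿ`. -/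
theorem liouville_orthogonal_circuit_scan_of_mullner
    (hM : Literature.NumberTheory.LFunctions.mullner_moebius_automatic) (S : ℕ) :
    ∀ ε : ℝ, 0 < ε → ∀ᶠ n : ℕ in atTop, ∀ C : Circuit (Fin n),
      (∃ (δ : Fin S → Bool → Fin S) (q₀ : Fin S) (τ : Fin S → Bool),
        ∀ x : Fin n → Bool, C.eval x = τ (List.foldl δ q₀ (List.ofFn x))) →
        |∑ N ∈ Finset.range (2 ^ n), ((ArithmeticFunction.liouville N : ℤ) : ℝ) *
            sgn (C.eval (fun i : Fin n => Nat.testBit N i))| ≤ ε * (2 : ℝ) ^ n := by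
  intro ε hε
  filter_upwards [liouville_orthogonal_scan_of_mullner hM S ε hε] with n hn C hC
  obtain ⟨δ, q₀, τ, hC⟩ := hC
  simp only [hC]
  exact (hn δ q₀ τ).1

/-- **The finite-state-scan rung in circuit language, MSB-first scans (modulo Müllner's theorem).**
As `liouville_orthogonal_circuit_scan_of_mullner`, for automata scanning `x_{n-1}, …, x₁, x₀`. -/
theorem liouville_orthogonal_circuit_scanMSB_of_mullner
    (hM : Literature.NumberTheory.LFunctions.mullner_moebius_automatic) (S : ℕ) :
    ∀ ε : ℝ, 0 < ε → ∀ᶠ n : ℕ in atTop, ∀ C : Circuit (Fin n),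
      (∃ (δ : Fin S → Bool → Fin S) (q₀ : Fin S) (τ : Fin S → Bool),
        ∀ x : Fin n → Bool, C.eval x = τ (List.foldl δ q₀ (List.ofFn x).reverse)) →
        |∑ N ∈ Finset.range (2 ^ n), ((ArithmeticFunction.liouville N : ℤ) : ℝ) *
            sgn (C.eval (fun i : Fin n => Nat.testBit N i))| ≤ ε * (2 : ℝ) ^ n := by
  intro ε hε
  filter_upwards [liouville_orthogonal_scan_of_mullner hM S ε hε] with n hn C hC
  obtain ⟨δ, q₀, τ, hC⟩ := hC
  simp only [hC]
  exact (hn δ q₀ τ).2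

end Summit.QuantumAdvantage.QuantumAdvantage.Theorems.LiouvilleOrthogonalTC0
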